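import Literature.NumberTheory.GaloisCohomology.Howard2004.SelmerTriples
import Literature.NumberTheory.GaloisRepresentations.GaloisH1MapBijectiveUnramified
import HarnessLib

/-!
# Howard 2004, Def. 1.1.8 / display (ks relations): the finite–singular comparison slot, PINNED

Topic `NumberTheory/GaloisCohomology/Howard2004` (sequel to `SelmerTriples` §G, tranche 4 of (W9);
cell `pub/bsd-print-x9`, lit g31 FINDING (E) 2026-08-28).  DEFINITIONS WITH BODIES ONLY (no named
fact, no instance, no `sorry`).

THE PROBLEM.  Howard's module of Kolyvagin systems `KS(T, F, 𝓛)` (Def. 1.2.3) is defined by the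
relations of display (ks relations) through THE finite–singular comparison isomorphism
«`φ^{fs}_ℓ : H¹_f(K_ℓ, T/I_{nℓ}T) ≅ H¹_s(K_ℓ, T/I_{nℓ}T) ⊗ G_ℓ`» [arXiv:1202.6340 p. 6, L126–131],
the map of Def. 1.1.8: «`φ^{fs}_v : H¹_f(K_v,T) ≅ T ≅ H¹_s(K_v,T) ⊗ k_vˣ` given by Proposition 1.1.7»
— evaluation at `Frob_v`, and `c ⊗ α ↦ c(σ_α)` with `σ_α` the Artin symbol of a lift of `α`
[p. 5, L115–131].  In `SelmerTriples.LevelData` the map is a SLOT `fs` (reading note (i) there);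
a statement quantifying over ALL slots is stronger than print (with `fs := 0` every family
supported at `n = 1` is a «Kolyvagin system»).  This file supplies the PIN as a predicate on the
slot, in the CFT-free form that print determines up to the print-derivable ambiguity:

* `localIntertwining`, `localH1Map`, `singularQuotientMap` — functoriality of `H¹(K_v, ·)` and of
  the singular quotient `H¹_s = H¹/H¹_ur` along an additive map of modules equivariant for the
  LOCAL Galois group `Γ_{K_v}` (`map_unramifiedSubgroup_le`);
* `LevelData.FsBijectiveAt D n v` — (i) `fs n v` restricted to `H¹_ur(K_v, T/I_nT)` is a bijection
  onto `H¹_s(K_v, T/I_nT) ⊗ G_ℓ` («`φ^{fs}` is an isomorphism», Def. 1.1.8);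
* `LevelData.FsNaturalAt D n n' v` — (ii) `fs` is NATURAL IN THE MODULE: for every `R`-linear map
  `g : T/I_nT → T/I_{n'}T` between the presentations that is `Γ_{K_v}`-equivariant,
  `fs n' v ∘ H¹(g) = (H¹_s(g) ⊗ 1) ∘ fs n v` on `H¹_ur` (Prop. 1.1.7 / Def. 1.1.8 are functorial in
  the module `T`: both «evaluation at the Frobenius» and «`c ⊗ α ↦ c(σ_α)`» commute with `g`);
* `LevelData.IsFsAdmissible D jbar` — (i) and (ii) at every level `n ∈ 𝓝(𝓛)` and prime `ℓ ∈ n`.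

READING NOTE (v) (why (i)+(ii) is a faithful pin; the two elementary lemmas are OWED, not
asserted here).  At `ℓ ∣ λ ∈ n ∈ 𝓝(𝓛)` the local group `Γ_{K_λ}` acts trivially on
`T' = T^{(k)}/I_n` (`λ ∈ 𝓛₀` is unramified of degree two and `Frob_λ ≡ 1 mod I_ℓ ⊆ I_n`), `T'` is
free of rank two over `R' = R_k/I_n` (H.0), `H¹_ur(K_λ, T') = Hom(Ẑ, T') ≅ T' ⊗_{R'} A` and
`H¹_s(K_λ, T') ⊗ G_ℓ ≅ Hom(k_λˣ, T') ⊗ G_ℓ ≅ T' ⊗_{R'} B` with `A ≅ B ≅ R'` free of rank one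
(`(ℓ + 1) T' = 0`); an additive map `T' ⊗ A → T' ⊗ B` commuting with `M₂(R') ⊗ 1` is `1 ⊗ φ₀`
with `φ₀ ∈ Hom_{R'}(A, B) ≅ R'`, a unit iff bijective.  Hence (i)+(ii) at `(n, λ)` give
`fs n λ = u_ℓ(n) · φ^{fs}_ℓ` with `u_ℓ(n) ∈ R'ˣ`, and (ii) along the transitions
`T/I_nT → T/I_{n'}T` (`n ⊆ n'`) gives `u_ℓ(n') ≡ u_ℓ(n)` (and `SatisfiesH.fs_natural` the
compatibility in `k`); then `κ ↦ κ″`, `κ″_n := (∏_{ℓ ∈ n} u_ℓ(n)) · κ_n`, is a bijection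
`KS(T, F, 𝓛; fs) → KS(T, F, 𝓛; φ^{fs})` with `κ″_1 = κ_1`, and the conclusion of Thm. 1.6.1 mentions
only `κ_1`.  So Thm. 1.6.1 for THE map `φ^{fs}` implies it for every admissible slot: the pinned
cite-only fact is NOT stronger than print.  (Scalar renormalisations transport Kolyvagin systems;
Howard's own `χ_n`-renormalisation, Thm. 1.7.5 [p. 14, L30–44], is the module-automorphism
version.  Bijectivity ALONE — the tree's Mazur–Rubin-style `KolyvaginDatum.IsAdmissible`, adequate
where `H¹_f(K_ℓ, T)` is free of rank ONE — is not enough here: `H¹_f(K_λ, T')` has rank two.)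
The VERBATIM pin («`EVAL(fs c) = c(Frob_λ)`» with `EVAL(s ⊗ ᾱ) = s(σ_α)` through the tree's pinned
local Artin map) implies (i)+(ii) and can be layered on top later; it differs from the
tame-character normalisation at most by `fs ↦ −fs`, transported by `κ_n ↦ (−1)^{|n|} κ_n`.
BSD is not proved by any of this.

References: B. Howard, *The Heegner point Kolyvagin system*, Compositio Math. 140 (2004),
Def. 1.1.8, Prop. 1.1.7, Def. 1.2.3 with display (ks relations), Thm. 1.7.5 (arXiv:1202.6340 pp. 5–7,
14); B. Mazur, K. Rubin, *Kolyvagin systems* (2004), Def. 1.2.2; K. Rubin, *Euler systems* (2000),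
Def. 4.4.? / Lemma 1.2.1 (the maps of Prop. 1.1.7).
-/

set_option autoImplicit false

noncomputable section

open Function NumberField IsDedekindDomain Field
open scoped NumberField ContRepresentation Classical TensorProduct

namespace Literature.NumberTheory.GaloisCohomology.Howard2004

open Literature.NumberTheory.GaloisRepresentations
open Literature.NumberTheory.GaloisRepresentations.DiscreteGaloisModule

/-! ## Functoriality of `H¹(K_v, ·)` and of the singular quotient along locally equivariant maps -/

section LocalFunctoriality

variable {K : Type} [Field K] [NumberField K]
  {N : Type} [AddCommGroup N] [TopologicalSpace N] [DiscreteTopology N]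
  {N' : Type} [AddCommGroup N'] [TopologicalSpace N'] [DiscreteTopology N']

/-- An additive map `g : N → N'` equivariant for the LOCAL Galois group `Γ_{K_v}` (acting on the two
discrete `Γ_K`-modules through `GaloisRep.toLocal v`), as an intertwining map of the local modules.
(At a Kolyvagin prime `λ ∈ n` the local action on `T/I_nT` is trivial, so every additive map is
locally equivariant there; globally it need not be.)
[cite: Howard2004HeegnerKolyvagin, Prop. 1.1.7 / Def. 1.1.8 (arXiv p. 5, L115–131), functoriality in `T`] -/
def localIntertwining (ρ : DiscreteGaloisModule K N) (ρ' : DiscreteGaloisModule K N')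
    (v : HeightOneSpectrum (𝓞 K)) (g : N →+ N')
    (hg : ∀ (σ : absoluteGaloisGroup (v.adicCompletion K)) (x : N),
      g (GaloisRep.toLocal v ρ σ x) = GaloisRep.toLocal v ρ' σ (g x)) :
    (GaloisRep.toLocal v ρ).toContRepresentation →ⁱL (GaloisRep.toLocal v ρ').toContRepresentation where
  toContinuousLinearMap := ⟨g.toIntLinearMap, continuous_of_discreteTopology⟩
  isIntertwining' σ := ContinuousLinearMap.ext fun x => hg σ x

/-- Unfolding `localIntertwining` on elements. [cite: Howard2004HeegnerKolyvagin, Def. 1.1.8 (arXiv p. 5)] -/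
@[simp] theorem localIntertwining_apply (ρ : DiscreteGaloisModule K N) (ρ' : DiscreteGaloisModule K N')
    (v : HeightOneSpectrum (𝓞 K)) (g : N →+ N')
    (hg : ∀ (σ : absoluteGaloisGroup (v.adicCompletion K)) (x : N),
      g (GaloisRep.toLocal v ρ σ x) = GaloisRep.toLocal v ρ' σ (g x)) (x : N) :
    localIntertwining ρ ρ' v g hg x = g x := rfl

/-- `H¹(K_v, g) : H¹(K_v, N) → H¹(K_v, N')` for a locally equivariant additive `g`.
[cite: Howard2004HeegnerKolyvagin, Prop. 1.1.7 (arXiv p. 5, L115–125), functoriality in `T`] -/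
def localH1Map (ρ : DiscreteGaloisModule K N) (ρ' : DiscreteGaloisModule K N')
    (v : HeightOneSpectrum (𝓞 K)) (g : N →+ N')
    (hg : ∀ (σ : absoluteGaloisGroup (v.adicCompletion K)) (x : N),
      g (GaloisRep.toLocal v ρ σ x) = GaloisRep.toLocal v ρ' σ (g x)) :
    galoisCohomology (GaloisRep.toLocal v ρ) 1 →+ galoisCohomology (GaloisRep.toLocal v ρ') 1 :=
  galoisCohomology.map (localIntertwining ρ ρ' v g hg) 1

/-- `H¹(K_v, g)` carries unramified classes to unramified classes (tree `map_unramifiedSubgroup_le`).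
[cite: Howard2004HeegnerKolyvagin, Def. 1.1.1 (arXiv p. 5, L49–51)] -/
theorem localH1Map_mem_unramifiedSubgroup (ρ : DiscreteGaloisModule K N) (ρ' : DiscreteGaloisModule K N')
    (v : HeightOneSpectrum (𝓞 K)) (g : N →+ N')
    (hg : ∀ (σ : absoluteGaloisGroup (v.adicCompletion K)) (x : N),
      g (GaloisRep.toLocal v ρ σ x) = GaloisRep.toLocal v ρ' σ (g x))
    {c : galoisCohomology (GaloisRep.toLocal v ρ) 1}
    (hc : c ∈ unramifiedSubgroup (GaloisRep.toLocal v ρ) 1) :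
    localH1Map ρ ρ' v g hg c ∈ unramifiedSubgroup (GaloisRep.toLocal v ρ') 1 :=
  galoisCohomology.map_unramifiedSubgroup_le (localIntertwining ρ ρ' v g hg) ⟨c, hc, rfl⟩

/-- **`H¹_s(K_v, g) : H¹_s(K_v, N) → H¹_s(K_v, N')`** on the singular quotients `H¹/H¹_ur`, induced by a
locally equivariant additive `g` (well defined by `localH1Map_mem_unramifiedSubgroup`).
[cite: Howard2004HeegnerKolyvagin, Def. 1.1.1 singular quotient and Prop. 1.1.7 (arXiv p. 5, L58–70, L115–125)] -/
def singularQuotientMap (ρ : DiscreteGaloisModule K N) (ρ' : DiscreteGaloisModule K N')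
    (v : HeightOneSpectrum (𝓞 K)) (g : N →+ N')
    (hg : ∀ (σ : absoluteGaloisGroup (v.adicCompletion K)) (x : N),
      g (GaloisRep.toLocal v ρ σ x) = GaloisRep.toLocal v ρ' σ (g x)) :
    SingularQuotient (GaloisRep.toLocal v ρ) →+ SingularQuotient (GaloisRep.toLocal v ρ') :=
  QuotientAddGroup.map _ _ (localH1Map ρ ρ' v g hg)
    fun _ hc => localH1Map_mem_unramifiedSubgroup ρ ρ' v g hg hc

/-- `H¹_s(g) ∘ loc^s = loc^s ∘ H¹(g)`. [cite: Howard2004HeegnerKolyvagin, Def. 1.1.1 (arXiv p. 5, L58–70)] -/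
@[simp] theorem singularQuotientMap_singularMap (ρ : DiscreteGaloisModule K N)
    (ρ' : DiscreteGaloisModule K N') (v : HeightOneSpectrum (𝓞 K)) (g : N →+ N')
    (hg : ∀ (σ : absoluteGaloisGroup (v.adicCompletion K)) (x : N),
      g (GaloisRep.toLocal v ρ σ x) = GaloisRep.toLocal v ρ' σ (g x))
    (c : galoisCohomology (GaloisRep.toLocal v ρ) 1) :
    singularQuotientMap ρ ρ' v g hg (singularMap _ c) = singularMap _ (localH1Map ρ ρ' v g hg c) :=
  rfl

end LocalFunctoriality

/-! ## The pin on the finite–singular slot of `LevelData` -/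

namespace LevelData

variable {K : Type} [Field K] [NumberField K] {M : Type} [AddCommGroup M] [TopologicalSpace M]
  [DiscreteTopology M] {R : Type} [CommRing R] [Module R M]
  {p : ℕ} {ρ : DiscreteGaloisModule K M} {t : SelmerTriple p ρ}
  {N : Finset (HeightOneSpectrum (𝓞 K)) → Type} [∀ n, AddCommGroup (N n)]
  [∀ n, TopologicalSpace (N n)] [∀ n, DiscreteTopology (N n)] [∀ n, Module R (N n)]

/-- **(i) `φ^{fs}_ℓ` is an isomorphism `H¹_f ≅ H¹_s ⊗ G_ℓ`** (Def. 1.1.8: «we define the finite-singular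
comparison map to be the isomorphism …»): the slot `fs n v`, restricted to the unramified (= finite)
classes of `H¹(K_v, T/I_nT)`, is a bijection onto `H¹_s(K_v, T/I_nT) ⊗ G_ℓ`.
[cite: Howard2004HeegnerKolyvagin, Def. 1.1.8 (arXiv Def. 2.1.8, p. 5, L126–131)] -/
def FsBijectiveAt (D : LevelData R ρ t N) (n : Finset (HeightOneSpectrum (𝓞 K)))
    (v : HeightOneSpectrum (𝓞 K)) : Prop :=
  Function.Bijective fun x : unramifiedSubgroup (GaloisRep.toLocal v (D.ρq n)) 1 =>
    D.fs n v (x : galoisCohomology (GaloisRep.toLocal v (D.ρq n)) 1)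

/-- **(ii) `φ^{fs}` is natural in the module**: for every `R`-linear map `g : T/I_nT → T/I_{n'}T`
between the presentations that is equivariant for the local group `Γ_{K_v}`, and every unramified
class `c` of `H¹(K_v, T/I_nT)`, `fs n' v (H¹(g) c) = (H¹_s(g) ⊗ 1) (fs n v c)` — the functoriality
in `T` of the isomorphisms of Prop. 1.1.7 («given on cocycles by evaluation at the Frobenius
automorphism, and … by `c ⊗ α ↦ c(σ_α)`», both commuting with `g`).  With `n = n'` this includes
naturality under all locally equivariant endomorphisms (hence `R`-linearity of `fs`).
[cite: Howard2004HeegnerKolyvagin, Prop. 1.1.7 and Def. 1.1.8 (arXiv p. 5, L115–131)] -/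
def FsNaturalAt (D : LevelData R ρ t N) (n n' : Finset (HeightOneSpectrum (𝓞 K)))
    (v : HeightOneSpectrum (𝓞 K)) : Prop :=
  ∀ (g : N n →ₗ[R] N n')
    (hg : ∀ (σ : absoluteGaloisGroup (v.adicCompletion K)) (x : N n),
      g (GaloisRep.toLocal v (D.ρq n) σ x) = GaloisRep.toLocal v (D.ρq n') σ (g x)),
    ∀ c ∈ unramifiedSubgroup (GaloisRep.toLocal v (D.ρq n)) 1,
      D.fs n' v (localH1Map (D.ρq n) (D.ρq n') v g.toAddMonoidHom hg c) =
        TensorProduct.map (singularQuotientMap (D.ρq n) (D.ρq n') v g.toAddMonoidHom hg).toIntLinearMap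
          LinearMap.id (D.fs n v c)

/-- **The finite–singular slot is THE comparison map of Def. 1.1.8** (up to the print-derivable
ambiguity of reading note (v)): at every level `n ∈ 𝓝(𝓛)` and every prime `ℓ ∣ λ ∈ n` — the pairs
`(nℓ, ℓ)` at which display (ks relations) evaluates `φ^{fs}_ℓ` — the slot is (i) bijective on the
finite classes and (ii) natural in the module along every locally equivariant `R`-linear map to the
presentation of any other level `n' ∈ 𝓝(𝓛)` containing `λ`.
[cite: Howard2004HeegnerKolyvagin, Def. 1.1.8 and Def. 1.2.3 with display (ks relations) (arXiv p. 5 L126–131, p. 6 L126 – p. 7 L12)] -/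
def IsFsAdmissible (D : LevelData R ρ t N) : Prop :=
  ∀ n ∈ t.levelSet, ∀ v ∈ n,
    D.FsBijectiveAt n v ∧ ∀ n' ∈ t.levelSet, v ∈ n' → D.FsNaturalAt n n' v

/-- Unfolding `IsFsAdmissible` at a pair `(n, λ)`, `λ ∈ n ∈ 𝓝(𝓛)`: bijectivity.
[cite: Howard2004HeegnerKolyvagin, Def. 1.1.8 (arXiv p. 5, L126–131)] -/
theorem IsFsAdmissible.fsBijectiveAt {D : LevelData R ρ t N} (h : D.IsFsAdmissible)
    {n : Finset (HeightOneSpectrum (𝓞 K))} (hn : n ∈ t.levelSet) {v : HeightOneSpectrum (𝓞 K)}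
    (hv : v ∈ n) : D.FsBijectiveAt n v :=
  (h n hn v hv).1

/-- Unfolding `IsFsAdmissible`: naturality between two levels containing `λ`.
[cite: Howard2004HeegnerKolyvagin, Prop. 1.1.7 / Def. 1.1.8 (arXiv p. 5, L115–131)] -/
theorem IsFsAdmissible.fsNaturalAt {D : LevelData R ρ t N} (h : D.IsFsAdmissible)
    {n n' : Finset (HeightOneSpectrum (𝓞 K))} (hn : n ∈ t.levelSet) (hn' : n' ∈ t.levelSet)
    {v : HeightOneSpectrum (𝓞 K)} (hv : v ∈ n) (hv' : v ∈ n') : D.FsNaturalAt n n' v :=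
  (h n hn v hv).2 n' hn' hv'

/-- Consequence of (ii) with `g = r • id`: the slot is `R`-linear on the finite classes,
`fs (r • c) = (r • ) ⊗ 1 (fs c)` where `r` acts on `H¹` through the module (tree `scalarMapH1` is
this `H¹(r • id)`). [cite: Howard2004HeegnerKolyvagin, Def. 1.1.1 («`R`-submodule») and Def. 1.1.8 (arXiv p. 5)] -/
theorem FsNaturalAt.smul {D : LevelData R ρ t N} {n : Finset (HeightOneSpectrum (𝓞 K))}
    {v : HeightOneSpectrum (𝓞 K)} (h : D.FsNaturalAt n n v) (r : R)
    (hlin : ∀ (σ : absoluteGaloisGroup (v.adicCompletion K)) (x : N n),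
      r • GaloisRep.toLocal v (D.ρq n) σ x = GaloisRep.toLocal v (D.ρq n) σ (r • x))
    (c : galoisCohomology (GaloisRep.toLocal v (D.ρq n)) 1)
    (hc : c ∈ unramifiedSubgroup (GaloisRep.toLocal v (D.ρq n)) 1) :
    D.fs n v (localH1Map (D.ρq n) (D.ρq n) v (r • LinearMap.id : N n →ₗ[R] N n).toAddMonoidHom
        (fun σ x => by simpa using hlin σ x) c) =
      TensorProduct.map (singularQuotientMap (D.ρq n) (D.ρq n) v
          (r • LinearMap.id : N n →ₗ[R] N n).toAddMonoidHom (fun σ x => by simpa using hlin σ x)).toIntLinearMap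
        LinearMap.id (D.fs n v c) :=
  h (r • LinearMap.id) (fun σ x => by simpa using hlin σ x) c hc

end LevelData

end Literature.NumberTheory.GaloisCohomology.Howard2004

end
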